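import Mathlib
import Summits.NavierStokesRegularity.FluidComputer.TransportCommutatorLattice
import HarnessLib

/-!
# The transport term on the lattice Sobolev scale, IV: commutators of every natural order (instab g19, cell `ns-blowup`, 2026-08-27)

HONEST FRAMING (human ruling D-0035): nothing here is a claim about Navier–Stokes blow-up.
WHAT THIS IS NOT: not NS evidence — lattice (`ℤ^d`, Fourier-side) inequalities between `ℝ≥0∞`
sums, Mathlib + the tree's `Lattice*` toolkit (Warner GTM 94, 6.17–6.18 as typed in
`Literature/Analysis/FunctionSpaces/Lattice*.lean`) only. No flow, operator, set `W` or certificate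
is constructed.

PURPOSE. The R-β KEEP/KILL emergence chain for the cell's MODEL host (forced ABC on `𝕋³`,
`TransportGalerkinAbcShift.half_prediction_abc_shift`, instab g18) has, besides the certificates, ONE
non-certificate input: RESIDENCE (β3) — the Galerkin levels of the perturbation equation stay in a
polynomial box `W` on the window (`HOME/instab/BETA2-SPEC.md` §6, there priced as computer-assisted
`C¹`-integration). For `ν > 0` residence is instead a consequence of the level-uniform `H²` bound that
the bootstrap itself supplies, via the classical `H^m` energy estimate: transport is skew, and the
commutator `[Λ^σ, û ⋆]∇û` costs `A₁(û) ‖û‖_σ` (Kato–Ponce shape), which dissipation absorbs. This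
file is the lattice toolkit of that estimate at EVERY natural order `σ ≥ 1` (part I,
`TransportCommutatorLattice`, is the case `σ = 2`):

* §1 `abs_sobolevWeight_natCast_sub_le` — the kernel bound
  `|⟨k⟩^σ − ⟨l⟩^σ| ≤ σ 2^{σ−1} ⟨k−l⟩ (⟨k−l⟩^{σ−1} + ⟨l⟩^{σ−1})` (`⟨·⟩ = Torus.sobolevWeight 1`,
  `1`-Lipschitz by `Torus.abs_sobolevWeight_one_sub_le`; telescoping `a^σ − b^σ`);
* §2 `eNormSq_wmul_natCast_conv_sub_le` — the ROUGH × ROUGH commutator estimate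
  `‖Λ^σ(a ⋆ g) − a ⋆ (Λ^σ g)‖₀² ≤ 2 (σ2^{σ−1})² (‖a‖_σ² A₀(g)² + A₁(a)² ‖g‖²_{σ−1})`
  (`A_r` = weighted `ℓ¹` norms; Young's inequality `Lattice.young_sq` once with the `ℓ²` weight on
  the symbol, once on the target) — the form in which BOTH factors are the unknown `û`;
* the companion file `TransportSobolevMultiplier.lean` carries the SMOOTH-MULTIPLIER form (all
  weight on the symbol; advection BY the smooth host) and Young + Peetre at any order `s ≥ 0` with
  the `ℓ¹` weight on the advected factor (the stretching term `(û·∇)U`).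

All statements are unconditional `ℝ≥0∞` inequalities except for the convergence hypotheses
(`RapidDecay a`, `Tempered g`) under which the commutator is termwise the kernel sum
(`Lattice.wmul_conv_sub_conv_wmul_apply`); on Galerkin levels every family is finitely supported.

References: F. W. Warner, GTM 94 (1983), 6.18 (17) [the negative-order commutator, tree
`Lattice.eNorm_wmul_conv_sub_le`]; T. Kato, G. Ponce, Comm. Pure Appl. Math. 41 (1988) 891–907
(the commutator estimate `‖[J^s, f]g‖ ≲ ‖∇f‖_∞‖J^{s−1}g‖ + ‖J^s f‖‖g‖_∞`, whose lattice/Wiener-algebra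
form §2 is) [folklore shape; constants here are crude and explicit].
-/

noncomputable section

open scoped ENNReal NNReal ComplexConjugate

namespace Summit.NavierStokesRegularity.FluidComputer.TransportSobolevCommutator

open Finset
open Literature.Analysis.FunctionSpaces Literature.Analysis.FunctionSpaces.Lattice
open Literature.Analysis.FunctionSpaces.Torus
open Summit.NavierStokesRegularity.FluidComputer.TransportCommutatorLattice

variable {d : Type*} [Fintype d]

/-! ## §1 The kernel bound of natural order -/

section Kernel

/-- `⟨k⟩^σ = ⟨k⟩₁^σ` for a natural exponent (`⟨k⟩_s = (1 + |k|²)^{s/2}`). -/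
theorem sobolevWeight_natCast (σ : ℕ) (k : d → ℤ) :
    sobolevWeight (σ : ℝ) k = sobolevWeight 1 k ^ σ := by
  rw [sobolevWeight, sobolevWeight, ← Real.rpow_natCast,
    ← Real.rpow_mul (by linarith [freqNormSq_nonneg k])]
  congr 1; ring

/-- Elementary: for reals `0 ≤ a`, `1 ≤ b`, `1 ≤ c` with `a ≤ b + c`, every product
`a^i b^{σ−1−i}` (`i < σ`) is at most `2^{σ−1} (c^{σ−1} + b^{σ−1})`. -/
theorem pow_mul_pow_le_of_le_add {a b c : ℝ} (ha : 0 ≤ a) (hb : 1 ≤ b) (hc : 1 ≤ c)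
    (habc : a ≤ b + c) {σ i : ℕ} (hi : i < σ) :
    a ^ i * b ^ (σ - 1 - i) ≤ (2 : ℝ) ^ (σ - 1) * (c ^ (σ - 1) + b ^ (σ - 1)) := by
  set M := max b c with hM
  have hM1 : 1 ≤ M := hb.trans (le_max_left _ _)
  have hM0 : 0 ≤ M := zero_le_one.trans hM1
  have haM : a ≤ 2 * M := by
    calc a ≤ b + c := habc
      _ ≤ M + M := add_le_add (le_max_left _ _) (le_max_right _ _)
      _ = 2 * M := by ring
  have hi' : i ≤ σ - 1 := Nat.le_sub_one_of_lt hi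
  have h1 : a ^ i ≤ (2 : ℝ) ^ i * M ^ i := by
    rw [← mul_pow]; exact pow_le_pow_left₀ ha haM i
  have h2 : b ^ (σ - 1 - i) ≤ M ^ (σ - 1 - i) :=
    pow_le_pow_left₀ (zero_le_one.trans hb) (le_max_left _ _) _
  have h3 : M ^ (σ - 1) ≤ c ^ (σ - 1) + b ^ (σ - 1) := by
    rcases le_total b c with hbc | hcb
    · rw [hM, max_eq_right hbc]
      exact le_add_of_nonneg_right (pow_nonneg (zero_le_one.trans hb) _)
    · rw [hM, max_eq_left hcb]
      exact le_add_of_nonneg_left (pow_nonneg (zero_le_one.trans hc) _)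
  calc a ^ i * b ^ (σ - 1 - i) ≤ ((2 : ℝ) ^ i * M ^ i) * M ^ (σ - 1 - i) :=
        mul_le_mul h1 h2 (pow_nonneg (zero_le_one.trans hb) _) (by positivity)
    _ = (2 : ℝ) ^ i * M ^ (σ - 1) := by
        rw [mul_assoc, ← pow_add, Nat.add_sub_cancel' hi']
    _ ≤ (2 : ℝ) ^ (σ - 1) * M ^ (σ - 1) :=
        mul_le_mul_of_nonneg_right (pow_le_pow_right₀ (by norm_num) hi') (pow_nonneg hM0 _)
    _ ≤ (2 : ℝ) ^ (σ - 1) * (c ^ (σ - 1) + b ^ (σ - 1)) :=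
        mul_le_mul_of_nonneg_left h3 (by positivity)

/-- **The kernel bound of the order-`σ` commutator** (`σ ∈ ℕ`):
`|⟨k⟩^σ − ⟨l⟩^σ| ≤ σ 2^{σ−1} ⟨k−l⟩ (⟨k−l⟩^{σ−1} + ⟨l⟩^{σ−1})` with `⟨·⟩ = ⟨·⟩₁`.
Telescoping `a^σ − b^σ = (a − b) ∑_{i<σ} a^i b^{σ−1−i}`, the `1`-Lipschitz bound
`|⟨k⟩ − ⟨l⟩| ≤ ⟨k − l⟩` (`Torus.abs_sobolevWeight_one_sub_le`) and `pow_mul_pow_le_of_le_add`. -/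
theorem abs_sobolevWeight_natCast_sub_le (σ : ℕ) (k l : d → ℤ) :
    |sobolevWeight (σ : ℝ) k - sobolevWeight (σ : ℝ) l| ≤
      σ * (2 : ℝ) ^ (σ - 1) * sobolevWeight 1 (k - l) *
        (sobolevWeight 1 (k - l) ^ (σ - 1) + sobolevWeight 1 l ^ (σ - 1)) := by
  set a := sobolevWeight 1 k with ha
  set b := sobolevWeight 1 l with hb
  set c := sobolevWeight 1 (k - l) with hc
  have ha0 : 0 ≤ a := (sobolevWeight_pos 1 k).le
  have hb1 : 1 ≤ b := one_le_sobolevWeight zero_le_one l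
  have hc1 : 1 ≤ c := one_le_sobolevWeight zero_le_one (k - l)
  have hb0 : 0 ≤ b := zero_le_one.trans hb1
  have hc0 : 0 ≤ c := zero_le_one.trans hc1
  have hlip : |a - b| ≤ c := abs_sobolevWeight_one_sub_le k l
  have habc : a ≤ b + c := by linarith [(abs_sub_le_iff.1 hlip).1]
  have hbac : b ≤ a + c := by linarith [(abs_sub_le_iff.1 hlip).2]
  rw [sobolevWeight_natCast, sobolevWeight_natCast, ← ha, ← hb]
  -- telescoping
  have htel : a ^ σ - b ^ σ = (∑ i ∈ range σ, a ^ i * b ^ (σ - 1 - i)) * (a - b) :=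
    (geom_sum₂_mul a b σ).symm
  have hS : |∑ i ∈ range σ, a ^ i * b ^ (σ - 1 - i)| ≤
      σ * ((2 : ℝ) ^ (σ - 1) * (c ^ (σ - 1) + b ^ (σ - 1))) := by
    rw [abs_of_nonneg (sum_nonneg fun i _ => by positivity)]
    calc ∑ i ∈ range σ, a ^ i * b ^ (σ - 1 - i)
        ≤ ∑ _i ∈ range σ, (2 : ℝ) ^ (σ - 1) * (c ^ (σ - 1) + b ^ (σ - 1)) :=
          sum_le_sum fun i hi => pow_mul_pow_le_of_le_add ha0 hb1 hc1 habc (mem_range.1 hi)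
      _ = σ * ((2 : ℝ) ^ (σ - 1) * (c ^ (σ - 1) + b ^ (σ - 1))) := by
          rw [sum_const, card_range, nsmul_eq_mul]
  calc |a ^ σ - b ^ σ| = |∑ i ∈ range σ, a ^ i * b ^ (σ - 1 - i)| * |a - b| := by
        rw [htel, abs_mul]
    _ ≤ σ * ((2 : ℝ) ^ (σ - 1) * (c ^ (σ - 1) + b ^ (σ - 1))) * c :=
        mul_le_mul hS hlip (abs_nonneg _) (by positivity)
    _ = σ * (2 : ℝ) ^ (σ - 1) * c * (c ^ (σ - 1) + b ^ (σ - 1)) := by ring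

/-- The SMOOTH-MULTIPLIER form of the kernel bound: all weight on `k − l`,
`|⟨k⟩^σ − ⟨l⟩^σ| ≤ σ 2^σ ⟨k−l⟩^σ ⟨l⟩^{σ−1}` (from `abs_sobolevWeight_natCast_sub_le` and
`x + y ≤ 2xy` for `x, y ≥ 1`). -/
theorem abs_sobolevWeight_natCast_sub_le' (σ : ℕ) (k l : d → ℤ) :
    |sobolevWeight (σ : ℝ) k - sobolevWeight (σ : ℝ) l| ≤
      σ * (2 : ℝ) ^ σ * sobolevWeight (σ : ℝ) (k - l) * sobolevWeight 1 l ^ (σ - 1) := by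
  have h := abs_sobolevWeight_natCast_sub_le σ k l
  set b := sobolevWeight 1 l with hb
  set c := sobolevWeight 1 (k - l) with hc
  have hb1 : 1 ≤ b := one_le_sobolevWeight zero_le_one l
  have hc1 : 1 ≤ c := one_le_sobolevWeight zero_le_one (k - l)
  have hx1 : 1 ≤ c ^ (σ - 1) := one_le_pow₀ hc1
  have hy1 : 1 ≤ b ^ (σ - 1) := one_le_pow₀ hb1
  have hxy : c ^ (σ - 1) + b ^ (σ - 1) ≤ 2 * (c ^ (σ - 1) * b ^ (σ - 1)) := by
    nlinarith [mul_nonneg (sub_nonneg.2 hx1) (sub_nonneg.2 hy1)]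
  rw [sobolevWeight_natCast σ (k - l), ← hc]
  rcases Nat.eq_zero_or_pos σ with rfl | hσ
  · simp
  calc |sobolevWeight (σ : ℝ) k - sobolevWeight (σ : ℝ) l|
      ≤ σ * (2 : ℝ) ^ (σ - 1) * c * (c ^ (σ - 1) + b ^ (σ - 1)) := h
    _ ≤ σ * (2 : ℝ) ^ (σ - 1) * c * (2 * (c ^ (σ - 1) * b ^ (σ - 1))) :=
        mul_le_mul_of_nonneg_left hxy (by positivity)
    _ = σ * ((2 : ℝ) ^ (σ - 1) * 2) * (c * c ^ (σ - 1)) * b ^ (σ - 1) := by ring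
    _ = σ * (2 : ℝ) ^ σ * c ^ σ * b ^ (σ - 1) := by
        rw [← pow_succ, ← pow_succ', Nat.sub_add_cancel hσ]

end Kernel

/-! ## §2 The rough × rough commutator estimate of natural order -/

section Commutator

variable {V W : Type*} [NormedAddCommGroup V] [NormedSpace ℂ V] [NormedAddCommGroup W]
  [NormedSpace ℂ W]

omit [Fintype d] in
/-- Swapping the two factors of a lattice convolution of `ℝ≥0∞` families:
`∑_l α(k − l) β(l) = ∑_l β(k − l) α(l)`. -/
theorem tsum_mul_sub_swap (α β : (d → ℤ) → ℝ≥0∞) (k : d → ℤ) :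
    ∑' l, α (k - l) * β l = ∑' l, β (k - l) * α l := by
  calc ∑' l, α (k - l) * β l = ∑' l, (fun m => α m * β (k - m)) (k - l) :=
        tsum_congr fun l => by simp only [sub_sub_cancel]
    _ = ∑' l, (fun m => α m * β (k - m)) l := tsum_sub_left_eq (fun m => α m * β (k - m)) k
    _ = ∑' l, β (k - l) * α l := tsum_congr fun l => mul_comm _ _

omit [Fintype d] in
/-- Young's inequality with the `ℓ²` weight on the factor at `k − l`:
`∑_k (∑_l α(k−l) β(l))² ≤ (∑ α²) (∑ β)²` (from `Lattice.young_sq` after `tsum_mul_sub_swap`). -/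
theorem young_sq' (α β : (d → ℤ) → ℝ≥0∞) :
    ∑' k, (∑' l, α (k - l) * β l) ^ 2 ≤ (∑' k, α k ^ 2) * (∑' l, β l) ^ 2 := by
  calc ∑' k, (∑' l, α (k - l) * β l) ^ 2 = ∑' k, (∑' l, β (k - l) * α l) ^ 2 :=
        tsum_congr fun k => by rw [tsum_mul_sub_swap]
    _ ≤ (∑' k, β k) ^ 2 * ∑' l, α l ^ 2 := young_sq β α
    _ = (∑' k, α k ^ 2) * (∑' l, β l) ^ 2 := mul_comm _ _

/-- **The commutator `[Λ^σ, a ⋆]` at natural order `σ ≥ 1`, rough × rough form** (squared):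
for a rapidly decreasing symbol `a` and a tempered family `g`,

  `‖Λ^σ(a ⋆ g) − a ⋆ (Λ^σ g)‖₀² ≤ 2 (σ 2^{σ−1})² ( ‖a‖_σ² · A₀(g)² + A₁(a)² · ‖g‖²_{σ−1} )`,

`A₀(g) = ∑_l ‖g l‖`, `A₁(a) = ∑_p ⟨p⟩ ‖a p‖` (`Lattice.symbNorm 1 a`), `‖a‖_σ² = Lattice.eNormSq σ a`.
Kernel bound `abs_sobolevWeight_natCast_sub_le`, then Young's inequality twice: the term
`⟨k−l⟩^σ ‖a(k−l)‖ · ‖g l‖` with the `ℓ²` norm on the symbol (`young_sq'`), the term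
`⟨k−l⟩ ‖a(k−l)‖ · ⟨l⟩^{σ−1} ‖g l‖` with the `ℓ²` norm on the target (`Lattice.young_sq`). This is the
lattice (Wiener-algebra) form of the Kato–Ponce commutator estimate; with `a = û_j`, `g = ∂_j û` both
terms are `≲ A₁(û) ‖û‖_σ`. -/
theorem eNormSq_wmul_natCast_conv_sub_le [CompleteSpace W] {a : (d → ℤ) → (V →L[ℂ] W)}
    (ha : RapidDecay a) {g : (d → ℤ) → V} (hg : Tempered g) {σ : ℕ} (hσ : 1 ≤ σ) :
    eNormSq 0 (wmul (σ : ℝ) (conv a g) - conv a (wmul (σ : ℝ) g)) ≤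
      2 * ENNReal.ofReal ((σ * (2 : ℝ) ^ (σ - 1)) ^ 2) *
        (eNormSq (σ : ℝ) a * (∑' l, ‖g l‖ₑ) ^ 2
          + symbNorm 1 a ^ 2 * eNormSq ((σ : ℝ) - 1) g) := by
  set C : ℝ := σ * (2 : ℝ) ^ (σ - 1) with hC
  have hC0 : 0 ≤ C := by positivity
  have hcast : (((σ - 1 : ℕ) : ℝ)) = (σ : ℝ) - 1 := by rw [Nat.cast_sub hσ, Nat.cast_one]
  -- the four `ℝ≥0∞` families
  obtain ⟨α₁, hα₁⟩ : ∃ α₁ : (d → ℤ) → ℝ≥0∞, ∀ p, α₁ p = ENNReal.ofReal (sobolevWeight (σ : ℝ) p * ‖a p‖) :=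
    ⟨_, fun _ => rfl⟩
  obtain ⟨β₁, hβ₁⟩ : ∃ β₁ : (d → ℤ) → ℝ≥0∞, ∀ l, β₁ l = ‖g l‖ₑ := ⟨_, fun _ => rfl⟩
  obtain ⟨α₂, hα₂⟩ : ∃ α₂ : (d → ℤ) → ℝ≥0∞, ∀ p, α₂ p = ENNReal.ofReal (sobolevWeight 1 p * ‖a p‖) :=
    ⟨_, fun _ => rfl⟩
  obtain ⟨β₂, hβ₂⟩ : ∃ β₂ : (d → ℤ) → ℝ≥0∞, ∀ l,
      β₂ l = ENNReal.ofReal (sobolevWeight ((σ : ℝ) - 1) l * ‖g l‖) := ⟨_, fun _ => rfl⟩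
  -- termwise bound
  have hterm : ∀ k, ‖(wmul (σ : ℝ) (conv a g) - conv a (wmul (σ : ℝ) g)) k‖ₑ ≤
      ENNReal.ofReal C * ((∑' l, α₁ (k - l) * β₁ l) + ∑' l, α₂ (k - l) * β₂ l) := by
    intro k
    rw [wmul_conv_sub_conv_wmul_apply ha hg, ← ENNReal.tsum_add, ← ENNReal.tsum_mul_left]
    refine enorm_tsum_le_tsum_enorm.trans (ENNReal.tsum_le_tsum fun l => ?_)
    rw [enorm_smul, ← ofReal_norm, ← ofReal_norm (a (k - l) (g l)), Complex.norm_real,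
      Real.norm_eq_abs]
    have hb := abs_sobolevWeight_natCast_sub_le σ k l
    have hcσ : sobolevWeight 1 (k - l) * sobolevWeight 1 (k - l) ^ (σ - 1) =
        sobolevWeight (σ : ℝ) (k - l) := by
      rw [sobolevWeight_natCast, ← pow_succ', Nat.sub_add_cancel hσ]
    have hbσ : sobolevWeight 1 l ^ (σ - 1) = sobolevWeight ((σ : ℝ) - 1) l := by
      rw [← hcast, sobolevWeight_natCast]
    have hag : ‖a (k - l) (g l)‖ ≤ ‖a (k - l)‖ * ‖g l‖ := (a (k - l)).le_opNorm _
    have hpos1 := sobolevWeight_pos (σ : ℝ) (k - l)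
    have hpos2 := sobolevWeight_pos 1 (k - l)
    have hpos3 := sobolevWeight_pos ((σ : ℝ) - 1) l
    have hpos4 := sobolevWeight_pos 1 l
    -- the real inequality
    have hreal : |sobolevWeight (σ : ℝ) k - sobolevWeight (σ : ℝ) l| * ‖a (k - l) (g l)‖ ≤
        C * ((sobolevWeight (σ : ℝ) (k - l) * ‖a (k - l)‖) * ‖g l‖
          + (sobolevWeight 1 (k - l) * ‖a (k - l)‖) * (sobolevWeight ((σ : ℝ) - 1) l * ‖g l‖)) := by
      calc |sobolevWeight (σ : ℝ) k - sobolevWeight (σ : ℝ) l| * ‖a (k - l) (g l)‖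
          ≤ (C * sobolevWeight 1 (k - l) *
              (sobolevWeight 1 (k - l) ^ (σ - 1) + sobolevWeight 1 l ^ (σ - 1))) *
              (‖a (k - l)‖ * ‖g l‖) :=
            mul_le_mul hb hag (norm_nonneg _) (by positivity)
        _ = C * ((sobolevWeight 1 (k - l) * sobolevWeight 1 (k - l) ^ (σ - 1) * ‖a (k - l)‖) * ‖g l‖
              + (sobolevWeight 1 (k - l) * ‖a (k - l)‖) * (sobolevWeight 1 l ^ (σ - 1) * ‖g l‖)) := by
            ring
        _ = _ := by rw [hcσ, hbσ]
    calc ENNReal.ofReal |sobolevWeight (σ : ℝ) k - sobolevWeight (σ : ℝ) l| *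
          ENNReal.ofReal ‖a (k - l) (g l)‖
        = ENNReal.ofReal (|sobolevWeight (σ : ℝ) k - sobolevWeight (σ : ℝ) l| * ‖a (k - l) (g l)‖) :=
          (ENNReal.ofReal_mul (abs_nonneg _)).symm
      _ ≤ ENNReal.ofReal (C * ((sobolevWeight (σ : ℝ) (k - l) * ‖a (k - l)‖) * ‖g l‖
          + (sobolevWeight 1 (k - l) * ‖a (k - l)‖) * (sobolevWeight ((σ : ℝ) - 1) l * ‖g l‖))) :=
          ENNReal.ofReal_le_ofReal hreal
      _ = ENNReal.ofReal C * (α₁ (k - l) * β₁ l + α₂ (k - l) * β₂ l) := by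
          have hx : 0 ≤ sobolevWeight (σ : ℝ) (k - l) * ‖a (k - l)‖ :=
            mul_nonneg hpos1.le (norm_nonneg _)
          have hy : 0 ≤ sobolevWeight 1 (k - l) * ‖a (k - l)‖ :=
            mul_nonneg hpos2.le (norm_nonneg _)
          have hz : 0 ≤ sobolevWeight ((σ : ℝ) - 1) l * ‖g l‖ :=
            mul_nonneg hpos3.le (norm_nonneg _)
          have e1 : ENNReal.ofReal ((sobolevWeight (σ : ℝ) (k - l) * ‖a (k - l)‖) * ‖g l‖) =
              α₁ (k - l) * β₁ l := by
            rw [hα₁, hβ₁, ENNReal.ofReal_mul hx, ofReal_norm]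
          have e2 : ENNReal.ofReal ((sobolevWeight 1 (k - l) * ‖a (k - l)‖) *
              (sobolevWeight ((σ : ℝ) - 1) l * ‖g l‖)) = α₂ (k - l) * β₂ l := by
            rw [hα₂, hβ₂, ENNReal.ofReal_mul hy]
          rw [ENNReal.ofReal_mul hC0, ENNReal.ofReal_add (mul_nonneg hx (norm_nonneg _))
            (mul_nonneg hy hz), e1, e2]
  -- identify the four sums
  have hα₁sum : ∑' p, α₁ p ^ 2 = eNormSq (σ : ℝ) a := tsum_congr fun p => by
    rw [hα₁, ← ENNReal.ofReal_pow (by positivity [sobolevWeight_pos (σ : ℝ) p]), mul_pow,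
      ENNReal.ofReal_mul (sq_nonneg _), ← ofReal_norm, ENNReal.ofReal_pow (norm_nonneg _)]
  have hβ₁sum : ∑' l, β₁ l = ∑' l, ‖g l‖ₑ := tsum_congr fun l => by rw [hβ₁]
  have hα₂sum : ∑' p, α₂ p = symbNorm 1 a := tsum_congr fun p => by
    rw [hα₂, ENNReal.ofReal_mul (sobolevWeight_pos _ _).le, ofReal_norm]
  have hβ₂sum : ∑' l, β₂ l ^ 2 = eNormSq ((σ : ℝ) - 1) g := tsum_congr fun l => by
    rw [hβ₂, ← ENNReal.ofReal_pow (by positivity [sobolevWeight_pos ((σ : ℝ) - 1) l]), mul_pow,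
      ENNReal.ofReal_mul (sq_nonneg _), ← ofReal_norm, ENNReal.ofReal_pow (norm_nonneg _)]
  -- sum the squares
  calc eNormSq 0 (wmul (σ : ℝ) (conv a g) - conv a (wmul (σ : ℝ) g))
      = ∑' k, ‖(wmul (σ : ℝ) (conv a g) - conv a (wmul (σ : ℝ) g)) k‖ₑ ^ 2 := by simp [eNormSq]
    _ ≤ ∑' k, (ENNReal.ofReal C * ((∑' l, α₁ (k - l) * β₁ l) + ∑' l, α₂ (k - l) * β₂ l)) ^ 2 :=
        ENNReal.tsum_le_tsum fun k => by gcongr; exact hterm k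
    _ ≤ ∑' k, ENNReal.ofReal C ^ 2 *
          (2 * (∑' l, α₁ (k - l) * β₁ l) ^ 2 + 2 * (∑' l, α₂ (k - l) * β₂ l) ^ 2) :=
        ENNReal.tsum_le_tsum fun k => by
          rw [mul_pow]; gcongr; exact ennreal_add_pow_two_le _ _
    _ = ENNReal.ofReal C ^ 2 * (2 * ∑' k, (∑' l, α₁ (k - l) * β₁ l) ^ 2
          + 2 * ∑' k, (∑' l, α₂ (k - l) * β₂ l) ^ 2) := by
        rw [ENNReal.tsum_mul_left, ENNReal.tsum_add, ENNReal.tsum_mul_left, ENNReal.tsum_mul_left]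
    _ ≤ ENNReal.ofReal C ^ 2 * (2 * ((∑' p, α₁ p ^ 2) * (∑' l, β₁ l) ^ 2)
          + 2 * ((∑' p, α₂ p) ^ 2 * ∑' l, β₂ l ^ 2)) := by
        gcongr
        · exact young_sq' α₁ β₁
        · exact young_sq α₂ β₂
    _ = 2 * ENNReal.ofReal (C ^ 2) *
        (eNormSq (σ : ℝ) a * (∑' l, ‖g l‖ₑ) ^ 2 + symbNorm 1 a ^ 2 * eNormSq ((σ : ℝ) - 1) g) := by
        rw [hα₁sum, hβ₁sum, hα₂sum, hβ₂sum, ENNReal.ofReal_pow hC0]; ring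

end Commutator

end Summit.NavierStokesRegularity.FluidComputer.TransportSobolevCommutator

end
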